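import Mathlib
import Summits.Ventures.HodgeRepro.Tier4.Common.AdelicDefs
import Summits.Ventures.HodgeRepro.Tier4.Common.MixedPlane
import Summits.Ventures.HodgeRepro.Tier4.Common.MixedPlaneKType
import Summits.Ventures.HodgeRepro.Tier4.Common.RowPlane
import Summits.Ventures.HodgeRepro.Tier4.Common.RowTorus
import Summits.Ventures.HodgeRepro.Tier4.Line4.LevelCosetCongruence
import Summits.Ventures.HodgeRepro.Tier4.Line4.BlockDetCongruence
import Summits.Ventures.HodgeRepro.Tier4.Line4.OrbitInvariant
import Summits.Ventures.HodgeRepro.Tier4.Line4.RationalLineScalars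

/-!
# Tier4/Line4/OrbitInvariantBridge — `orbitInv` IS L2-p3's `nrmK` of the `(0,0)` row scalar (the bridge of S15168 (c))

Blind re-derivation cell `pub-hodge-repro`, Tier 4 «prove the step» (README §9–§10), seat t4-L1-p3 (gen 4).
Tree path `lean/Summits/Ventures/HodgeRepro/Tier4/Line4/OrbitInvariantBridge.lean`.

On the transported row plane `W = (ofLinesRow q a b ε).withTransportedTorus g g' …` with `q.t = 0` (so `Ω² = −q.n`,
L2-p3's `d = q.n`), take the rows `w₀ := e₀` (spanning the `P₀`-line) and `v₀ := e₀ g'` (spanning the `Q₀`-line,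
`v₀ Q₀ = v₀`).  For a matrix `m` commuting with `Ω` (the `k`-matrix of a rational point) the `(0,0)` row scalar of
L2-p3's row model — `(w₀ m) Q₀ = v₀ · escK x y` — is `x = (m g) 0 0`, `y = (m g) 1 0`
(`row_coords_orbitInv`), and its norm `nrmK q.n x y = x² + q.n y²` is `orbitInvK g m`, the `k`-form of the orbit
invariant (`orbitInvK_eq_nrmK`).  Hence L2-p3's fibre theorem `orbitOf_eq_of_scalar_nrm_eq` (OrbitFibre: the
`(0,0)`-norm is injective on regular rational double cosets) applies to `orbitInv`: on the regular locus the fibre of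
`orbitInvOrbit` has ONE element.

Block facts used: the top-left block of a matrix commuting with `blockDiag4R ω ω` commutes with `ω`, hence is
`blockOf t n (M 0 0) (M 1 0)` (`commute_omegaMatR_iff`), and its determinant is the norm form.
No printed input.  HC_CM is NOT proved by anyone in this repository.
-/

namespace Summit.Ventures.HodgeRepro.Tier4.Line4

open Summit.Ventures.HodgeRepro.Tier4.Common NumberField Matrix
open scoped NumberField

noncomputable section

section Blocks

variable {R : Type} [CommRing R]

/-- The top-left block of a matrix commuting with `blockDiag4R A A` commutes with `A`. -/
theorem blockTL_mul_comm_of_comm {M : Matrix (Fin 4) (Fin 4) R} (A : Matrix (Fin 2) (Fin 2) R)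
    (h : M * blockDiag4R A A = blockDiag4R A A * M) : blockTL M * A = A * blockTL M := by
  rw [← blockTL_mul_blockDiag4R M A A, h, blockTL_blockDiag4R_mul]

/-- The top-left block of a matrix commuting with `blockDiag4R ω ω` is `blockOf t n (M 0 0) (M 1 0)`. -/
theorem blockTL_eq_blockOf_of_comm {t n : R} {M : Matrix (Fin 4) (Fin 4) R}
    (h : M * blockDiag4R (omegaMatR t n) (omegaMatR t n) = blockDiag4R (omegaMatR t n) (omegaMatR t n) * M) :
    blockTL M = blockOf t n (M 0 0) (M 1 0) := by
  have hc := blockTL_mul_comm_of_comm (omegaMatR t n) h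
  rw [commute_omegaMatR_iff] at hc
  rw [hc, blockOf, blockTL_apply, blockTL_apply]
  rfl

/-- Its determinant is the norm form `x² + t x y + n y²` of `x = M 0 0`, `y = M 1 0`. -/
theorem det_blockTL_eq_of_comm {t n : R} {M : Matrix (Fin 4) (Fin 4) R}
    (h : M * blockDiag4R (omegaMatR t n) (omegaMatR t n) = blockDiag4R (omegaMatR t n) (omegaMatR t n) * M) :
    (blockTL M).det = M 0 0 ^ 2 + t * M 0 0 * M 1 0 + n * M 1 0 ^ 2 := by
  rw [blockTL_eq_blockOf_of_comm h, det_blockOf]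

/-- The `(0, 1)` entry of such a matrix is `−n · M 1 0`. -/
theorem apply_zero_one_of_comm {t n : R} {M : Matrix (Fin 4) (Fin 4) R}
    (h : M * blockDiag4R (omegaMatR t n) (omegaMatR t n) = blockDiag4R (omegaMatR t n) (omegaMatR t n) * M) :
    M 0 1 = -(n * M 1 0) := by
  have h01 := congrFun (congrFun (blockTL_eq_blockOf_of_comm h) 0) 1
  rw [blockTL_apply] at h01
  have : M (Fin.castAdd 2 0) (Fin.castAdd 2 1) = M 0 1 := rfl
  rw [this] at h01
  rw [h01]
  simp [blockOf, omegaMatR, mul_comm]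

/-- The projector `blockDiag4R 1 0`, explicitly. -/
theorem blockDiag4R_one_zero_eq :
    blockDiag4R (1 : Matrix (Fin 2) (Fin 2) R) 0 = !![1, 0, 0, 0; 0, 1, 0, 0; 0, 0, 0, 0; 0, 0, 0, 0] := by
  ext i j
  fin_cases i <;> fin_cases j <;> rfl

/-- The block-diagonal `ω ⊕ ω`, explicitly. -/
theorem blockDiag4R_omegaMatR_eq (t n : R) :
    blockDiag4R (omegaMatR t n) (omegaMatR t n) = !![0, -n, 0, 0; 1, t, 0, 0; 0, 0, 0, -n; 0, 0, 1, t] := by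
  ext i j
  fin_cases i <;> fin_cases j <;> rfl

end Blocks

section Bridge

variable {k : Type} [Field k] [NumberField k] (q : QuadData k) (a b ε : k)
  (g g' : Matrix (Fin 4) (Fin 4) k) (hgg' : g * g' = 1) (hg'g : g' * g = 1)
  (hgΩ : g * (PlaneData.ofLinesRow q a b ε).Ω = (PlaneData.ofLinesRow q a b ε).Ω * g)

omit [NumberField k] in
/-- `Ω` of the row plane is the block-diagonal `ω ⊕ ω` over the ring `k`. -/
theorem ofLinesRow_Ω_eq_blockDiag4R :
    (PlaneData.ofLinesRow q a b ε).Ω = blockDiag4R (omegaMatR q.t q.n) (omegaMatR q.t q.n) := rfl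

omit [NumberField k] in
/-- `P 0` of the row plane is `blockDiag4R 1 0`. -/
theorem ofLinesRow_P_zero_eq : (PlaneData.ofLinesRow q a b ε).P 0 = blockDiag4R 1 0 := rfl

omit [NumberField k] in
include hgΩ in
/-- **`orbitInvK` is the norm of the `(0,0)` scalar**: for `m` commuting with `Ω` and `q.t = 0`,
`orbitInvK g m = nrmK q.n ((m g) 0 0) ((m g) 1 0)`. -/
theorem orbitInvK_eq_nrmK (ht : q.t = 0) {m : Matrix (Fin 4) (Fin 4) k}
    (hmΩ : m * (PlaneData.ofLinesRow q a b ε).Ω = (PlaneData.ofLinesRow q a b ε).Ω * m) :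
    orbitInvK g m = nrmK q.n ((m * g) 0 0) ((m * g) 1 0) := by
  have hMΩ : (m * g) * (PlaneData.ofLinesRow q a b ε).Ω = (PlaneData.ofLinesRow q a b ε).Ω * (m * g) := by
    rw [Matrix.mul_assoc, hgΩ, ← Matrix.mul_assoc, hmΩ, Matrix.mul_assoc]
  rw [ofLinesRow_Ω_eq_blockDiag4R] at hMΩ
  unfold orbitInvK nrmK
  rw [det_blockTL_eq_of_comm hMΩ, ht]
  ring

omit [NumberField k] in
/-- **The row coordinates of the `(0,0)` scalar**: with `w₀ = e₀` (the `P₀`-line) and `v₀ = e₀ g'` (the `Q₀`-line),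
`(w₀ m) Q₀ = v₀ · escK W x y` for `x = (m g) 0 0`, `y = (m g) 1 0` — L2-p3's row-model coordinates of
`orbitInv`. -/
theorem row_coords_orbitInv {m : Matrix (Fin 4) (Fin 4) k}
    (hmΩ : m * (PlaneData.ofLinesRow q a b ε).Ω = (PlaneData.ofLinesRow q a b ε).Ω * m) :
    ((Pi.single 0 1 : Fin 4 → k) ᵥ* m) ᵥ* ((PlaneData.ofLinesRow q a b ε).withTransportedTorus g g' hgg' hg'g hgΩ).Q 0
      = ((Pi.single 0 1 : Fin 4 → k) ᵥ* g') ᵥ*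
        escK ((PlaneData.ofLinesRow q a b ε).withTransportedTorus g g' hgg' hg'g hgΩ) ((m * g) 0 0) ((m * g) 1 0) := by
  have hMΩ : (m * g) * (PlaneData.ofLinesRow q a b ε).Ω = (PlaneData.ofLinesRow q a b ε).Ω * (m * g) := by
    rw [Matrix.mul_assoc, hgΩ, ← Matrix.mul_assoc, hmΩ, Matrix.mul_assoc]
  have hg'Ω := g'_comm_Ω q a b ε g g' hgg' hg'g hgΩ
  have hQ : ((PlaneData.ofLinesRow q a b ε).withTransportedTorus g g' hgg' hg'g hgΩ).Q 0 =
      g * (PlaneData.ofLinesRow q a b ε).P 0 * g' := rfl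
  have hΩ : ((PlaneData.ofLinesRow q a b ε).withTransportedTorus g g' hgg' hg'g hgΩ).Ω =
      (PlaneData.ofLinesRow q a b ε).Ω := rfl
  set M := m * g with hM
  set x := M 0 0 with hx
  set y := M 1 0 with hy
  set E := x • (1 : Matrix (Fin 4) (Fin 4) k) + y • (PlaneData.ofLinesRow q a b ε).Ω with hE
  have hcomm : g' * E = E * g' := by
    rw [hE, Matrix.mul_add, Matrix.add_mul, Matrix.mul_smul, Matrix.smul_mul, Matrix.mul_smul, Matrix.smul_mul,
      Matrix.mul_one, Matrix.one_mul, hg'Ω]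
  -- row `0` of `M P₀` is row `0` of `E`
  have key : (Pi.single 0 1 : Fin 4 → k) ᵥ* (M * (PlaneData.ofLinesRow q a b ε).P 0) =
      (Pi.single 0 1 : Fin 4 → k) ᵥ* E := by
    rw [ofLinesRow_Ω_eq_blockDiag4R] at hMΩ
    have h01 : M 0 1 = -(q.n * M 1 0) := apply_zero_one_of_comm hMΩ
    rw [hE, ofLinesRow_P_zero_eq, ofLinesRow_Ω_eq_blockDiag4R, blockDiag4R_one_zero_eq, blockDiag4R_omegaMatR_eq,
      Matrix.single_one_vecMul, Matrix.single_one_vecMul]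
    ext j
    fin_cases j <;> simp [Matrix.row, Matrix.mul_apply, Fin.sum_univ_four, h01, hx, hy, mul_comm]
  have hE' : escK ((PlaneData.ofLinesRow q a b ε).withTransportedTorus g g' hgg' hg'g hgΩ) x y = E := by
    rw [escK, hΩ]
  rw [hE', hQ]
  calc ((Pi.single 0 1 : Fin 4 → k) ᵥ* m) ᵥ* (g * (PlaneData.ofLinesRow q a b ε).P 0 * g')
      = (Pi.single 0 1 : Fin 4 → k) ᵥ* (M * (PlaneData.ofLinesRow q a b ε).P 0 * g') := by
        rw [Matrix.vecMul_vecMul, hM]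
        simp only [Matrix.mul_assoc]
    _ = ((Pi.single 0 1 : Fin 4 → k) ᵥ* (M * (PlaneData.ofLinesRow q a b ε).P 0)) ᵥ* g' := by
        rw [Matrix.vecMul_vecMul]
    _ = ((Pi.single 0 1 : Fin 4 → k) ᵥ* E) ᵥ* g' := by rw [key]
    _ = (Pi.single 0 1 : Fin 4 → k) ᵥ* (E * g') := by rw [Matrix.vecMul_vecMul]
    _ = (Pi.single 0 1 : Fin 4 → k) ᵥ* (g' * E) := by rw [hcomm]
    _ = ((Pi.single 0 1 : Fin 4 → k) ᵥ* g') ᵥ* E := by rw [Matrix.vecMul_vecMul]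

omit [NumberField k] in
include hgΩ in
/-- **v2 (append) — the norm form for GENERAL `q.t`** (crit-1 S15229: the wall's `q` has `t` free): for `m` commuting
with `Ω`, `orbitInvK g m = x² + q.t · x y + q.n · y²` with `x = (m g) 0 0`, `y = (m g) 1 0` — the
`N_{E′/k}(x + y ω)` of the `(0,0)` scalar in the basis `(1, ω)`, `ω² = t ω − n`; the `t = 0` case is
`orbitInvK_eq_nrmK`. -/
theorem orbitInvK_eq_normForm {m : Matrix (Fin 4) (Fin 4) k}
    (hmΩ : m * (PlaneData.ofLinesRow q a b ε).Ω = (PlaneData.ofLinesRow q a b ε).Ω * m) :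
    orbitInvK g m = (m * g) 0 0 ^ 2 + q.t * (m * g) 0 0 * (m * g) 1 0 + q.n * (m * g) 1 0 ^ 2 := by
  have hMΩ : (m * g) * (PlaneData.ofLinesRow q a b ε).Ω = (PlaneData.ofLinesRow q a b ε).Ω * (m * g) := by
    rw [Matrix.mul_assoc, hgΩ, ← Matrix.mul_assoc, hmΩ, Matrix.mul_assoc]
  rw [ofLinesRow_Ω_eq_blockDiag4R] at hMΩ
  unfold orbitInvK
  exact det_blockTL_eq_of_comm hMΩ

end Bridge

end

end Summit.Ventures.HodgeRepro.Tier4.Line4
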